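import Summits.ABC.IUTFork.Conditional.FreyHullThresholdGenuineWild
import Summits.ABC.IUTFork.Cor312GenuineKWildDifferentExact
import Summits.ABC.IUTFork.Cor312GenuineKWildExactTriple
import HarnessLib

/-!
# Branch C / R-W «GENUINE-NEG» ENGINE at a W2 wild pole `p ∈ {3, 5}` of a rational-point datum, with the EXACT different:
# if the `δ`-cell FAILS at the DECIDED local type `e = p(p−1)·r·l` with `δ = e + e/p − 1`, then S_H FAILS at every genuine Θ-volume datum

PROOF-ONLY file (D-0012: 0 definitions, 0 `Prop` facts, no instance, no notation) of the abc-iut cell (rung LADDER-ABC:A2.RESCUE.W; seat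
abc-iut-w5-d180 gen 10, row «W:REF-BANDS-WILD-EXACT», plan C-R88 (a)(ii)). TAKES NO SIDE on [IUTchIII] Cor. 3.12 (S. Mochizuki, *Inter-universal
Teichmüller theory III*, Cor. 3.12 p. 173–174, Step (xi-f) p. 184) or on any author: every statement is about OUR typed objects
(`Thm311.Real.settingPrVolSharp` at `Cor312Prov.pilotDataOfK`, `presAt` / typed (Ind1)(Ind2), `Thm311ToCor312.Licence`, `Cor312Vol.PilotKummerCompatHull`);
the hull-level licence is a STRONGER-THAN-PRINT reading of Step (xi-f); typed ≠ proved; refuted-as-typed ≠ refuted-in-print; no abc claim.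

WHAT. The W2 specialisation of abc-iut-w4-d094's class engine `GenuineK.not_pilotKummerCompatHull_chosen_ratPoint_of_wildCells`
(`Conditional/FreyHullThresholdGenuineWild`, p492774; proof structure reproduced verbatim with credit), with TWO inputs sharpened BY NAME: at a pole
with `p ∣ t` and `v_p(u^{p−1} − 1) = 1` (`u = j(q₀)⁻¹/p^{2t}`; abc-iut-W-neg-1's unit test) the local type is DECIDED —
`e(K_{x₀}/ℚ_p) = p(p−1)·(p′/gcd(p′,t))·l` (`GenuineK.absRamificationIdx_kOf_eq_wildUnit_ratPoint`) — so the cell is required at that ONE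
`A = p(p−1)·(p′/gcd(p′,t))` only, and the different of the diagonal packet is the EXACT `d = (e + e/p − 1)/e` (abc-iut-w5-d180's
`GenuineK.differentOrd_kOf_eq_wildUnit_ratPoint`, Euler + tame equality) instead of Dedekind's `(2e − 1)/e`: the cell's `δ` drops from `2e − 1` to
`e + e/p − 1` (by `e(p−1)/p`, e.g. `2e/3` at `p = 3`), which is what extends the REFUTED bands of the W2 data (desk: 223³-triple @ 5 band
3,049 → 4,079; 5¹¹·31·191-triple @ 3 band 178,754 → 956,537). Everything else (`fibre_nonempty`, `placeOf_mem_S_ratPoint`, `P_q = A·t` via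
`Cor312Prov.qPilot_pilotDataOfK_eq_of_ord_rat`, inner/outer radii from abc-iut-rh-typ-4's `HexHullThreshold`, `differentOrd_le_differentOrd_dFac`,
`not_licence_settingPrVolSharp_of_cellFail`, `licence_of_pilotKummerCompatHull`) is cited BY NAME exactly as in the parent engine.
* `GenuineK.not_pilotKummerCompatHull_chosen_ratPoint_of_wildUnitCell` — pole form (`ord_{(p)} j(q₀) = −2t`, `p ∣ t`, unit test `= 1`);
* `GenuineK.not_pilotKummerCompatHull_chosen_triple_of_wildUnitCell` — abc-triple form (`λ = a/c`, `p^t ∥ abc`, `p ∣ t`, `p ∣ D`, `p² ∤ D` with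
  `D = ((abc/p^t)²)^{p−1} − (2⁸(cb + a²)³)^{p−1}`, abc-iut-W-neg-1's `RadTriple.unit_test_of_dvd_of_not_sq_dvd`).
HONEST SCOPE: SHARP reading; a failing top-label diagonal packet says NOTHING about the printed GLOBAL inequality, the number-level
`Cor22.Cor312AtDatum`, or any author's intended hull; admissibility / Szpiro-badness / (P6) and NON-EMPTINESS of the datum type are NOT claimed;
typed ≠ proved; refuted-as-typed ≠ refuted-in-print; no abc claim.
[cite: Mochizuki2012, IUTchIII Cor. 3.12 Step (xi-f) p. 184; IUTchIV Prop. 1.1 p. 9, Prop. 1.2 (i)(ii) p. 10, Prop. 1.3 (i) p. 11, Thm. 1.10 p. 22, Cor. 2.2 (ii) proof (P5) p. 46]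
[cite: DupuyHilado2025, §3.4, §4.9, §4.12] [cite: SerreLocalFields1979, Ch. III §6 Prop. 13] [cite: Serre1973, Ch. II §3.3] [cite: SilvermanAEC2009, Prop. III.1.7(b)]
[claim: Mochizuki2012, status: disputed] for every IUT quotation.
-/

noncomputable section

open Set Function NumberField IsDedekindDomain

namespace Summit.ABC.IUTFork.Conditional

section Engine

open Thm311 Thm311.Real Cor312 Cor312Vol Cor312Prov Literature.IUT.LogThetaLattice Literature.IUT.LogVolume
  Literature.IUT.HodgeTheaters Literature.IUT.LogVolume.ThetaData
  Literature.NumberTheory.NumberFields Literature.NumberTheory.DiophantineGeometry.GenEll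
  Literature.NumberTheory.DiophantineGeometry Summit.ABC.ABC.Theorems Literature.NumberTheory.GaloisRepresentations.Ultrametric

/-- **ENGINE — GENUINE-NEG THROUGH THE EXACT `δ`-CELL AT A W2 WILD POLE.** `q₀ ∈ ℚ`, a genuine Θ-volume datum `T` over `(ratPoint q₀, l)`, a prime
`p ∈ {3, 5}` (`p′ = 15/p`), `p ≠ l`, a pole of `j(q₀)` at `p` of order `2t` with `p ∣ t` and `v_p(u^{p−1} − 1) = 1` (type W2), a label `i + 1 ≤ l⋆`.
IF at `A = p(p−1)·(p′/gcd(p′,t))` the `δ`-cell FAILS at `e = A·l`, `P_q = A·t`, `r_in = ⌊e/(p−1)⌋ + 1`, `r_out = p^{a₀} − a₀·e` (`a₀` the turning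
point) and the EXACT `δ = e + e/p − 1`, THEN for EVERY choice of the free context binders and Kummer data `Cor312Vol.PilotKummerCompatHull` at
`settingPrVolSharp (pilotDataOfK T.D T.K) …` with the CHOSEN realising ideles and the PINNED reading FAILS. Proof = abc-iut-w4-d094's engine verbatim
with the exact type and the exact different BY NAME (see the module docstring). SHARP reading; refuted-as-typed only; nothing about the number-level
Corollary; admissibility / (P6) / non-emptiness of the datum type NOT claimed.
[cite: Mochizuki2012, IUTchIII Cor. 3.12 Step (xi-f) p. 184; IUTchIV Prop. 1.1 p. 9, Prop. 1.2 (i)(ii) p. 10, Prop. 1.3 (i) p. 11, Thm. 1.10 p. 22]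
[cite: DupuyHilado2025, §3.4, §4.9, §4.12] [cite: SerreLocalFields1979, Ch. III §6 Prop. 13] [cite: Serre1973, Ch. II §3.3]
[claim: Mochizuki2012, status: disputed] -/
theorem GenuineK.not_pilotKummerCompatHull_chosen_ratPoint_of_wildUnitCell {q₀ : ℚ} {l : ℕ}
    (T : Cor22.ThetaVolumeDatumAt (ratPoint q₀) l) (pp : Nat.Primes) {p' : ℕ}
    (hpq : ((pp : ℕ) = 3 ∧ p' = 5) ∨ ((pp : ℕ) = 5 ∧ p' = 3)) (hpl : (pp : ℕ) ≠ l) {t : ℕ} (ht : 0 < t)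
    (hpole : ∀ v : HeightOneSpectrum (𝓞 ℚ), Rat.HeightOneSpectrum.natGenerator v = pp →
      Literature.IUT.LogVolume.ord ℚ v (Cor22.jInv q₀) = -(2 * (t : ℤ))) (hpt : (pp : ℕ) ∣ t)
    (hunit : padicValRat pp ((((Cor22.jInv q₀)⁻¹ / ((pp : ℕ) : ℚ) ^ (2 * t)) ^ ((pp : ℕ) - 1) - 1)) = 1)
    {i : ℕ} (hi : i + 1 ≤ (l - 1) / 2)
    (hcell : ∀ A : ℕ, A = (pp : ℕ) * ((pp : ℕ) - 1) * (p' / Nat.gcd p' t) →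
      ∃ a₀ : ℕ, (∀ a, a < a₀ → (1 : ℤ) * ((pp : ℕ) : ℤ) ^ a * (((pp : ℕ) : ℤ) - 1) < ((A * l : ℕ) : ℤ)) ∧
        ((A * l : ℕ) : ℤ) ≤ 1 * ((pp : ℕ) : ℤ) ^ a₀ * (((pp : ℕ) : ℤ) - 1) ∧
        ((A * t : ℕ) : ℤ) - (((i : ℕ) : ℤ) + 1 + 1) * (((pp : ℕ) : ℤ) ^ a₀ - (a₀ : ℤ) * ((A * l : ℕ) : ℤ)) <
          ((A * l : ℕ) : ℤ) * (((((i : ℕ) : ℤ) + 1) ^ 2 * ((A * t : ℕ) : ℤ)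
            - (((i : ℕ) : ℤ) + 1) * ((A * l + A * l / (pp : ℕ) - 1 : ℕ) : ℤ)
            - (((i : ℕ) : ℤ) + 1 + 1) * (((A * l) / ((pp : ℕ) - 1) + 1 : ℕ) : ℤ)) / ((A * l : ℕ) : ℤ))) :
    letI := T.instFieldF; letI := T.instNumberFieldF; letI := T.instAlgebraF; letI := T.instFieldK
    letI := T.instNumberFieldK; letI := T.instAlgebraK; letI := T.instFieldFbar; letI := T.instAlgebraFbar
    letI := T.instAlgebraKFbar; letI := T.instIsElliptic
    ∀ (M : Type) [Field M] [NumberField M]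
      (archPk : ∀ (j : (thetaIndex (pilotDataOfK T.D T.K)).Label) (vQ : (thetaIndex (pilotDataOfK T.D T.K)).VQ),
        Set ((logShellsDH (pilotDataOfK T.D T.K) (analyticLogv T.K)).Packet j vQ))
      (archSub : ∀ (j : (thetaIndex (pilotDataOfK T.D T.K)).Label) (v : (thetaIndex (pilotDataOfK T.D T.K)).V),
        Set ((logShellsDH (pilotDataOfK T.D T.K) (analyticLogv T.K)).Packet j ((thetaIndex (pilotDataOfK T.D T.K)).over v)))
      (Ψ : ℤ → ∀ v : (thetaIndex (pilotDataOfK T.D T.K)).V, v ∈ (thetaIndex (pilotDataOfK T.D T.K)).Vbad →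
        Set ((logShellsDH (pilotDataOfK T.D T.K) (analyticLogv T.K)).StarPacket v))
      (act : ℤ → ∀ v : (thetaIndex (pilotDataOfK T.D T.K)).V, v ∈ (thetaIndex (pilotDataOfK T.D T.K)).Vbad →
        (logShellsDH (pilotDataOfK T.D T.K) (analyticLogv T.K)).StarPacket v →
          Module.End ℚ ((logShellsDH (pilotDataOfK T.D T.K) (analyticLogv T.K)).StarPacket v))
      (Mmod : ℤ → ∀ j : (thetaIndex (pilotDataOfK T.D T.K)).LabelStar,
        Set ((logShellsDH (pilotDataOfK T.D T.K) (analyticLogv T.K)).GlobalPacket j.1))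
      (region : ℤ → ∀ j : (thetaIndex (pilotDataOfK T.D T.K)).LabelStar, FinDivisor M →
        ∀ vQ : (thetaIndex (pilotDataOfK T.D T.K)).VQ, Set ((logShellsDH (pilotDataOfK T.D T.K) (analyticLogv T.K)).Packet j.1 vQ))
      (frobAdm : ℤ → ℤ → ∀ (j : (thetaIndex (pilotDataOfK T.D T.K)).Label) (vQ : (thetaIndex (pilotDataOfK T.D T.K)).VQ),
        Set ((logShellsDH (pilotDataOfK T.D T.K) (analyticLogv T.K)).Packet j vQ) → Prop)
      (frobLogvol : ℤ → ℤ → ∀ (j : (thetaIndex (pilotDataOfK T.D T.K)).Label) (vQ : (thetaIndex (pilotDataOfK T.D T.K)).VQ),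
        Set ((logShellsDH (pilotDataOfK T.D T.K) (analyticLogv T.K)).Packet j vQ) → ℝ)
      (frobΨ : ℤ → ℤ → ∀ v : (thetaIndex (pilotDataOfK T.D T.K)).V, v ∈ (thetaIndex (pilotDataOfK T.D T.K)).Vbad →
        Set ((logShellsDH (pilotDataOfK T.D T.K) (analyticLogv T.K)).StarPacket v))
      (frobMmod : ℤ → ℤ → ∀ j : (thetaIndex (pilotDataOfK T.D T.K)).LabelStar,
        Set ((logShellsDH (pilotDataOfK T.D T.K) (analyticLogv T.K)).GlobalPacket j.1))
      (unitImage : ℤ → ℤ → ℕ → ∀ (j : (thetaIndex (pilotDataOfK T.D T.K)).Label) (vQ : (thetaIndex (pilotDataOfK T.D T.K)).VQ),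
        Set ((logShellsDH (pilotDataOfK T.D T.K) (analyticLogv T.K)).Packet j vQ))
      (ballImage : ℤ → ℤ → ∀ (j : (thetaIndex (pilotDataOfK T.D T.K)).Label) (vQ : (thetaIndex (pilotDataOfK T.D T.K)).VQ),
        Set ((logShellsDH (pilotDataOfK T.D T.K) (analyticLogv T.K)).Packet j vQ))
      (thetaDiv : ℤ → ℤ → LgpDivisor M (thetaIndex (pilotDataOfK T.D T.K)).lstar)
      (n : ℤ) {HT : Type} {LogLink : HT → HT → Type} {IsFull : ∀ {s t : HT}, LogLink s t → Prop}
      (lat : LGPGaussianLogThetaLattice LogLink IsFull)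
      {Frd : Type} {IsoF : Frd → Frd → Type} {Ob : Frd → Type} {realify : Frd → Frd} {Strip : Type}
      {IsoS : Strip → Strip → Type} {Mv : ∀ v : (thetaIndex (pilotDataOfK T.D T.K)).V, v ∈ (thetaIndex (pilotDataOfK T.D T.K)).Vbad → Type}
      [∀ v h, Monoid (Mv v h)]
      (sig : GlobalLGPFrobenioidSignature (thetaIndex (pilotDataOfK T.D T.K)).lstar (thetaIndex (pilotDataOfK T.D T.K)).V
        (· ∈ (thetaIndex (pilotDataOfK T.D T.K)).Vbad) Frd IsoF Ob realify Strip IsoS Mv)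
      (split : SplittingMonoids Mv) {ObΔ : Type}
      {N : ∀ v : (thetaIndex (pilotDataOfK T.D T.K)).V, v ∈ (thetaIndex (pilotDataOfK T.D T.K)).Vbad → Type}
      [∀ v h, Monoid (N v h)] (qData : QPilotData ObΔ N)
      (qK : ∀ v : (thetaIndex (pilotDataOfK T.D T.K)).V, v ∈ (thetaIndex (pilotDataOfK T.D T.K)).Vbad →
        Set ((logShellsDH (pilotDataOfK T.D T.K) (analyticLogv T.K)).StarPacket v)),
    ¬ Cor312Vol.PilotKummerCompatHull
        (LatticeSituation.ofShells (logShellsDH (pilotDataOfK T.D T.K) (analyticLogv T.K)) M archPk archSub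
          (summandPiecesPr (pilotDataOfK T.D T.K) (logvAnalytic_analyticLogv (F := T.K))).Adm
          (summandPiecesPr (pilotDataOfK T.D T.K) (logvAnalytic_analyticLogv (F := T.K))).logvol Ψ act Mmod region frobAdm
          frobLogvol frobΨ frobMmod unitImage ballImage thetaDiv)
        (settingPrVolSharp (pilotDataOfK T.D T.K) (logvAnalytic_analyticLogv (F := T.K)) M archPk archSub Ψ act Mmod region n
          lat sig split qData (exists_realising_qIdeles_pilotDataOfK T.D).choose (exists_realising_thetaIdeles_pilotDataOfK T.D).choose
          (exists_realising_qIdeles_pilotDataOfK T.D).choose_spec.1 (exists_realising_qIdeles_pilotDataOfK T.D).choose_spec.2.1)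
        (fun _ => Cor312.Setting.qRegion
          (settingPrVolSharp (pilotDataOfK T.D T.K) (logvAnalytic_analyticLogv (F := T.K)) M archPk archSub Ψ act Mmod region n
            lat sig split qData (exists_realising_qIdeles_pilotDataOfK T.D).choose (exists_realising_thetaIdeles_pilotDataOfK T.D).choose
            (exists_realising_qIdeles_pilotDataOfK T.D).choose_spec.1 (exists_realising_qIdeles_pilotDataOfK T.D).choose_spec.2.1))
        qK := by
  letI := T.instFieldF; letI := T.instNumberFieldF; letI := T.instAlgebraF; letI := T.instFieldK
  letI := T.instNumberFieldK; letI := T.instAlgebraK; letI := T.instFieldFbar; letI := T.instAlgebraFbar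
  letI := T.instAlgebraKFbar; letI := T.instIsElliptic
  intro M _ _ archPk archSub Ψ act Mmod region frobAdm frobLogvol frobΨ frobMmod
    unitImage ballImage thetaDiv n HT LogLink IsFull lat Frd IsoF Ob realify Strip IsoS Mv _ sig split ObΔ N _ qData qK hSH
  have hp : (pp : ℕ).Prime := pp.2
  haveI hpF : Fact (pp : ℕ).Prime := ⟨hp⟩
  have hp2 : (pp : ℕ) ≠ 2 := by rcases hpq with ⟨h, -⟩ | ⟨h, -⟩ <;> omega
  have hl : l.Prime := T.D.l_prime
  have hL := licence_of_pilotKummerCompatHull (hq := fun _ _ => rfl) (hc := hSH)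
  set X := pilotDataOfK T.D T.K with hXdef
  have hlogA : LogvAnalytic (analyticLogv T.K) := logvAnalytic_analyticLogv (F := T.K)
  have htq0 := (exists_realising_qIdeles_pilotDataOfK T.D).choose_spec.1
  have htq := (exists_realising_qIdeles_pilotDataOfK T.D).choose_spec.2.2
  have ht0' := (exists_realising_thetaIdeles_pilotDataOfK T.D).choose_spec.1; have ht' := (exists_realising_thetaIdeles_pilotDataOfK T.D).choose_spec.2.2
  have hpR : (1 : ℝ) < ((pp : ℕ) : ℝ) := by exact_mod_cast hp.one_lt
  have hl0r : (0 : ℝ) < l := by exact_mod_cast hl.pos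
  have ht0z : (0 : ℤ) < t := by exact_mod_cast ht
  have hpole' : ∀ v : HeightOneSpectrum (𝓞 ℚ), Rat.HeightOneSpectrum.natGenerator v = pp →
      Literature.IUT.LogVolume.ord ℚ v (Cor22.jInv q₀) < 0 := fun v hv => by
    rw [hpole v hv]; linarith
  obtain ⟨vx, hvx⟩ := (thetaIndex X).fibre_nonempty (.inr pp)
  set x₀ : (thetaIndex X).Fibre (.inr pp) := ⟨vx, hvx⟩ with hx₀def
  have hS : placeOf X pp.1 x₀ ∈ X.S := Hex.placeOf_mem_S_ratPoint T pp hp2 hpl hpole' x₀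
  have hlstar : (thetaIndex X).lstar = (l - 1) / 2 := by
    show ((pilotDataOfK T.D T.K).l - 1) / 2 = (l - 1) / 2; rw [pilotDataOfK_l]
  have hil : i < (thetaIndex X).lstar := by rw [hlstar]; omega
  -- the local type: `e = A·l` with `A = e(w | p)` in the class of §4
  set u := placeOf X pp.1 x₀ with hudef
  have hpu : ((pp : ℕ) : 𝓞 T.K) ∈ u.asIdeal := natCast_mem_placeOf X pp.1 x₀
  set w := finBelow T.F T.K u with hwdef
  set A : ℕ := w.asIdeal.ramificationIdx ℤ with hAdef
  set e : ℕ := absRamificationIdx (pp : ℕ) (kOf X pp.1 x₀) with hedef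
  have heAl : e = A * l := GenuineK.absRamificationIdx_kOf_eq_mul_prime_ratPoint T pp hp2 hpl hpole' x₀
  -- the EXACT W2 type (abc-iut-W-neg-1): `A = p(p−1)·(p′/gcd(p′,t))`
  have heexact := GenuineK.absRamificationIdx_kOf_eq_wildUnit_ratPoint T pp hpq hpl ht hpt hpole hunit x₀
  have hAeq : A = (pp : ℕ) * ((pp : ℕ) - 1) * (p' / Nat.gcd p' t) := by
    have h1 : A * l = (pp : ℕ) * ((pp : ℕ) - 1) * (p' / Nat.gcd p' t) * l := by rw [← heAl]; exact heexact
    exact Nat.eq_of_mul_eq_mul_right hl.pos h1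
  obtain ⟨a₀, hlo, hhi, hneg⟩ := hcell A hAeq
  have he0 : 0 < e := absRamificationIdx_pos (pp : ℕ) _
  have he0r : (0 : ℝ) < e := by exact_mod_cast he0
  have heram : ramIdx T.K u = e := by
    rw [hedef, ramIdx_eq]; exact (absRamificationIdx_rescaledCompletion T.K (pp : ℕ) u hpu).symm
  -- the pilot degree `P_q(x₀) = A·t`
  have hj : T.E.j = ((Cor22.jInv q₀ : ℚ) : T.F) := by rw [T.j_eq]; exact eq_ratCast _ _
  have hordu : Literature.IUT.LogVolume.ord ℚ (finBelow ℚ T.K u) (Cor22.jInv q₀) = -((2 * t : ℕ) : ℤ) := by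
    rw [hpole _ (natGenerator_finBelow_placeOf T.D pp x₀)]; push_cast; ring
  have hP : X.qPilot u = ((A * t : ℕ) : ℝ) := by
    have h := qPilot_pilotDataOfK_eq_of_ord_rat T.D (Cor22.jInv q₀) hj pp x₀ hS heAl hordu
    rw [h]
    have hl0' : (l : ℝ) ≠ 0 := hl0r.ne'
    push_cast
    field_simp
  -- the inner / outer radii at every fibre point (abc-iut-rh-typ-4 §1)
  have hIn : ∀ (qq : Nat.Primes) (x : (thetaIndex X).Fibre (.inr qq)),
      haveI : Fact (qq : ℕ).Prime := ⟨qq.2⟩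
      ∃ (c : (presAt X hlogA qq).k x) (ϖ : ((presAt X hlogA qq).k x)ˣ) (w : (presAt X hlogA qq).k x), c ≠ 0 ∧
        (∀ o : (presAt X hlogA qq).k x, ‖o‖ ≤ 1 → c * o ∈ logUnits ((presAt X hlogA qq).k x)) ∧
        IsUniformizer ϖ ∧ w ∉ logUnits ((presAt X hlogA qq).k x) ∧ ‖w‖ * ‖(ϖ : (presAt X hlogA qq).k x)‖ ≤ ‖c‖ := fun qq x => by
    haveI : Fact (qq : ℕ).Prime := ⟨qq.2⟩
    exact HexHullThreshold.exists_innerRadius (qq : ℕ) ((presAt X hlogA qq).k x)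
  choose cin ϖ wv hin0 hin hunif hwv hwle using hIn
  have hOut : ∀ (qq : Nat.Primes) (x : (thetaIndex X).Fibre (.inr qq)),
      haveI : Fact (qq : ℕ).Prime := ⟨qq.2⟩
      ∃ c : (presAt X hlogA qq).k x, c ∈ logUnits ((presAt X hlogA qq).k x) ∧ c ≠ 0 ∧
        ∀ z ∈ logUnits ((presAt X hlogA qq).k x), ‖z‖ ≤ ‖c‖ := fun qq x => by
    haveI : Fact (qq : ℕ).Prime := ⟨qq.2⟩
    exact HexHullThreshold.exists_outerRadius (qq : ℕ) ((presAt X hlogA qq).k x)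
  choose cout houtΛ hout0 hdom using hOut
  have hek : absRamificationIdx (pp : ℕ) ((presAt X hlogA pp).k x₀) = A * l := heAl
  have heram' : (ramIdx T.K (placeOf X pp.1 x₀) : ℤ) = ((A * l : ℕ) : ℤ) := by rw [← hudef, heram, heAl]
  have hAl0r : (0 : ℝ) < ((A * l : ℕ) : ℝ) := by rw [← heAl]; exact he0r
  -- the p − 1 arithmetic
  have hpm1pos : 0 < (pp : ℕ) - 1 := by have := hp.two_le; omega
  refine not_licence_settingPrVolSharp_of_cellFail X hlogA M archPk archSub Ψ act Mmod region n lat sig split qData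
    (exists_realising_qIdeles_pilotDataOfK T.D).choose (exists_realising_thetaIdeles_pilotDataOfK T.D).choose htq0
    (exists_realising_qIdeles_pilotDataOfK T.D).choose_spec.2.1 ht0' ht' htq cin cout hin0 hin
    (fun qq x => ⟨ϖ qq x, wv qq x, hunif qq x, hwv qq x, hwle qq x⟩) hout0 houtΛ hdom
    pp ⟨i, hil⟩ x₀ (P := A * t) (rin := (((A * l) / ((pp : ℕ) - 1) + 1 : ℕ) : ℤ))
    (rout := ((pp : ℕ) : ℤ) ^ a₀ - (a₀ : ℤ) * ((A * l : ℕ) : ℤ))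
    (δ := ((A * l + A * l / (pp : ℕ) - 1 : ℕ) : ℤ)) hP ?_ ?_ ?_ ?_ hL
  · -- hcin: `p^{−r_in/e} ≤ ‖cin x₀‖`
    have hr : 1 / (((pp : ℕ) : ℝ) - 1) < (((((A * l) / ((pp : ℕ) - 1) + 1 : ℕ) : ℤ)) : ℝ) /
        (absRamificationIdx (pp : ℕ) ((presAt X hlogA pp).k x₀) : ℝ) := by
      rw [hek]
      have hdiv : A * l < ((pp : ℕ) - 1) * ((A * l) / ((pp : ℕ) - 1) + 1) := Nat.lt_mul_div_succ (A * l) hpm1pos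
      rw [lt_div_iff₀ hAl0r]
      have hdivr : (((A * l : ℕ)) : ℝ) < ((((pp : ℕ) - 1 : ℕ)) : ℝ) * ((((A * l) / ((pp : ℕ) - 1) + 1 : ℕ)) : ℝ) := by
        exact_mod_cast hdiv
      have hp1r : ((((pp : ℕ) - 1 : ℕ)) : ℝ) = ((pp : ℕ) : ℝ) - 1 := by
        rw [Nat.cast_sub hp.one_lt.le]; simp
      rw [hp1r] at hdivr
      have hpos : (0 : ℝ) < ((pp : ℕ) : ℝ) - 1 := by linarith
      simp only [Int.cast_natCast]
      rw [div_mul_eq_mul_div, one_mul, div_lt_iff₀ hpos]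
      linarith
    have h := HexHullThreshold.rpow_le_norm_of_innerRadius (pp : ℕ) _ (hunif _ x₀) (hwv _ x₀) (hwle _ x₀) hr
    rw [hek] at h
    rw [heram']
    convert h using 2
    push_cast
    ring
  · -- hcout: `‖cout x₀‖ ≤ p^{−r_out/e}`
    have hlo' : ∀ a < a₀, (1 : ℤ) * (((pp : ℕ) : ℕ) : ℤ) ^ a * ((((pp : ℕ) : ℕ) : ℤ) - 1) <
        absRamificationIdx (pp : ℕ) ((presAt X hlogA pp).k x₀) := by
      rw [hek]; exact fun a ha => hlo a ha
    have hhi' : (absRamificationIdx (pp : ℕ) ((presAt X hlogA pp).k x₀) : ℤ) ≤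
        1 * (((pp : ℕ) : ℕ) : ℤ) ^ a₀ * ((((pp : ℕ) : ℕ) : ℤ) - 1) := by
      rw [hek]; exact hhi
    have h := HexHullThreshold.norm_le_rpow_of_mem_logUnits_turning (pp : ℕ) _ hlo' hhi' (houtΛ _ x₀)
    rw [hek] at h
    rw [heram']
    convert h using 2
  · -- hd: the different defect of the diagonal packet, by DEDEKIND (§3)
    intro J
    have hcard : Fintype.card ((thetaIndex X).Caps (Setting.labelSucc ⟨i, hil⟩)) = i + 2 := by
      rw [Fintype.card_fin]
      simp only [Setting.labelSucc, Fin.val_succ]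
    -- `d(K_{x₀}) = δ/e` EXACTLY at the W2 pole (abc-iut-w5-d180 `GenuineK.differentOrd_kOf_eq_wildUnit_ratPoint`)
    have hded : differentOrd (pp : ℕ) ((presAt X hlogA pp).k x₀) ≤
        (((A * l + A * l / (pp : ℕ) - 1 : ℕ) : ℝ)) / ((A * l : ℕ) : ℝ) := by
      have h1 : differentOrd (pp : ℕ) ((presAt X hlogA pp).k x₀) = differentOrd (pp : ℕ) (kOf X pp.1 x₀) := rfl
      have h2 := GenuineK.differentOrd_kOf_eq_wildUnit_ratPoint T pp hpq hpl ht hpt hpole hunit x₀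
      rw [h1, h2, ← hedef, heAl]
    have hfac := differentOrd_le_differentOrd_dFac (pp : ℕ) ((presAt X hlogA pp).kk
      (fun _ : (thetaIndex X).Caps (Setting.labelSucc ⟨i, hil⟩) => x₀)) (Fin.last _) J
    have hsum : dSum (pp : ℕ) ((presAt X hlogA pp).kk (fun _ : (thetaIndex X).Caps (Setting.labelSucc ⟨i, hil⟩) => x₀)) =
        ((i : ℝ) + 2) * differentOrd (pp : ℕ) ((presAt X hlogA pp).k x₀) := by
      unfold dSum
      dsimp only [Cor312Vol.PadicPresentation.kk]
      rw [Finset.sum_const, Finset.card_univ, hcard, nsmul_eq_mul]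
      push_cast
      ring
    rw [heram', hsum]
    have hfac' : differentOrd (pp : ℕ) ((presAt X hlogA pp).k x₀) ≤
        differentOrd (pp : ℕ) (DFac (pp : ℕ) ((presAt X hlogA pp).kk
          (fun _ : (thetaIndex X).Caps (Setting.labelSucc ⟨i, hil⟩) => x₀)) J) := hfac
    have hd0 : 0 ≤ differentOrd (pp : ℕ) ((presAt X hlogA pp).k x₀) := differentOrd_nonneg (pp : ℕ) _
    have hI : (((⟨i, hil⟩ : Fin (thetaIndex X).lstar) : ℕ) : ℤ) = (i : ℤ) := rfl
    rw [hI]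
    set d := differentOrd (pp : ℕ) ((presAt X hlogA pp).k x₀) with hd_def
    set δr : ℝ := (((A * l + A * l / (pp : ℕ) - 1 : ℕ) : ℝ)) with hδr
    have hi0 : (0 : ℝ) ≤ (i : ℝ) + 1 := by positivity
    have step1 : ((i : ℝ) + 2) * d - differentOrd (pp : ℕ) (DFac (pp : ℕ) ((presAt X hlogA pp).kk
          (fun _ : (thetaIndex X).Caps (Setting.labelSucc ⟨i, hil⟩) => x₀)) J) ≤ ((i : ℝ) + 1) * d := by linarith
    have step2 : ((i : ℝ) + 1) * d ≤ ((i : ℝ) + 1) * (δr / ((A * l : ℕ) : ℝ)) := mul_le_mul_of_nonneg_left hded hi0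
    refine step1.trans (step2.trans (le_of_eq ?_))
    rw [hδr]
    push_cast
    ring
  · -- hneg: the cell fails at `(e, P_q, r_in, r_out, δ) = (A·l, A·t, ⌊A·l/(p−1)⌋+1, p^{a₀} − a₀·A·l, A·l + A·l/p − 1)`
    rw [heram']
    exact hneg

/-- **abc-TRIPLE form of the W2 engine.** `a + b = c` coprime, `λ = a/c`, `p ∈ {3, 5}` (`p′ = 15/p`), `p ≠ l`, `p^t ∥ abc` with `p ∣ t`, and the W2
unit test read off the triple — `p ∣ D`, `p² ∤ D`, `D = ((abc/p^t)²)^{p−1} − (2⁸(cb + a²)³)^{p−1}` (abc-iut-W-neg-1's `RadTriple.unit_test_of_dvd_of_not_sq_dvd`) —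
a label `i + 1 ≤ l⋆`, and the EXACT `δ`-cell FAILING at `A = p(p−1)·(p′/gcd(p′,t))` ⇒ ¬ S_H (chosen realising ideles, pinned reading) at EVERY genuine
Θ-volume datum over `(ratPoint (a/c), l)`. NOT claimed: admissibility / Szpiro-badness / (P6), non-emptiness of the datum type.
[cite: Mochizuki2012, IUTchIV Cor. 2.2 (ii) proof p. 44; IUTchIII Cor. 3.12 Step (xi-f) p. 184] [cite: SilvermanAEC2009, Prop. III.1.7(b)] [cite: Serre1973, Ch. II §3.3]
[claim: Mochizuki2012, status: disputed] -/
theorem GenuineK.not_pilotKummerCompatHull_chosen_triple_of_wildUnitCell {a b c : ℕ} (habc : IsABCTriple a b c) {l : ℕ}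
    (T : Cor22.ThetaVolumeDatumAt (ratPoint ((a : ℚ) / c)) l) (pp : Nat.Primes) {p' : ℕ}
    (hpq : ((pp : ℕ) = 3 ∧ p' = 5) ∨ ((pp : ℕ) = 5 ∧ p' = 3)) (hpl : (pp : ℕ) ≠ l) {t : ℕ} (ht : 0 < t)
    (hdvd : (pp : ℕ) ^ t ∣ a * b * c) (hndvd : ¬ (pp : ℕ) ^ (t + 1) ∣ a * b * c) (hpt : (pp : ℕ) ∣ t)
    (hD1 : ((pp : ℕ) : ℤ) ∣ (((a * b * c / (pp : ℕ) ^ t : ℕ) : ℤ) ^ 2) ^ ((pp : ℕ) - 1) - ((256 * (c * b + a * a) ^ 3 : ℕ) : ℤ) ^ ((pp : ℕ) - 1))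
    (hD2 : ¬ (((pp : ℕ) : ℤ) ^ 2) ∣
      (((a * b * c / (pp : ℕ) ^ t : ℕ) : ℤ) ^ 2) ^ ((pp : ℕ) - 1) - ((256 * (c * b + a * a) ^ 3 : ℕ) : ℤ) ^ ((pp : ℕ) - 1))
    {i : ℕ} (hi : i + 1 ≤ (l - 1) / 2)
    (hcell : ∀ A : ℕ, A = (pp : ℕ) * ((pp : ℕ) - 1) * (p' / Nat.gcd p' t) →
      ∃ a₀ : ℕ, (∀ a, a < a₀ → (1 : ℤ) * ((pp : ℕ) : ℤ) ^ a * (((pp : ℕ) : ℤ) - 1) < ((A * l : ℕ) : ℤ)) ∧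
        ((A * l : ℕ) : ℤ) ≤ 1 * ((pp : ℕ) : ℤ) ^ a₀ * (((pp : ℕ) : ℤ) - 1) ∧
        ((A * t : ℕ) : ℤ) - (((i : ℕ) : ℤ) + 1 + 1) * (((pp : ℕ) : ℤ) ^ a₀ - (a₀ : ℤ) * ((A * l : ℕ) : ℤ)) <
          ((A * l : ℕ) : ℤ) * (((((i : ℕ) : ℤ) + 1) ^ 2 * ((A * t : ℕ) : ℤ)
            - (((i : ℕ) : ℤ) + 1) * ((A * l + A * l / (pp : ℕ) - 1 : ℕ) : ℤ)
            - (((i : ℕ) : ℤ) + 1 + 1) * (((A * l) / ((pp : ℕ) - 1) + 1 : ℕ) : ℤ)) / ((A * l : ℕ) : ℤ))) :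
    letI := T.instFieldF; letI := T.instNumberFieldF; letI := T.instAlgebraF; letI := T.instFieldK
    letI := T.instNumberFieldK; letI := T.instAlgebraK; letI := T.instFieldFbar; letI := T.instAlgebraFbar
    letI := T.instAlgebraKFbar; letI := T.instIsElliptic
    ∀ (M : Type) [Field M] [NumberField M]
      (archPk : ∀ (j : (thetaIndex (pilotDataOfK T.D T.K)).Label) (vQ : (thetaIndex (pilotDataOfK T.D T.K)).VQ),
        Set ((logShellsDH (pilotDataOfK T.D T.K) (analyticLogv T.K)).Packet j vQ))
      (archSub : ∀ (j : (thetaIndex (pilotDataOfK T.D T.K)).Label) (v : (thetaIndex (pilotDataOfK T.D T.K)).V),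
        Set ((logShellsDH (pilotDataOfK T.D T.K) (analyticLogv T.K)).Packet j ((thetaIndex (pilotDataOfK T.D T.K)).over v)))
      (Ψ : ℤ → ∀ v : (thetaIndex (pilotDataOfK T.D T.K)).V, v ∈ (thetaIndex (pilotDataOfK T.D T.K)).Vbad →
        Set ((logShellsDH (pilotDataOfK T.D T.K) (analyticLogv T.K)).StarPacket v))
      (act : ℤ → ∀ v : (thetaIndex (pilotDataOfK T.D T.K)).V, v ∈ (thetaIndex (pilotDataOfK T.D T.K)).Vbad →
        (logShellsDH (pilotDataOfK T.D T.K) (analyticLogv T.K)).StarPacket v →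
          Module.End ℚ ((logShellsDH (pilotDataOfK T.D T.K) (analyticLogv T.K)).StarPacket v))
      (Mmod : ℤ → ∀ j : (thetaIndex (pilotDataOfK T.D T.K)).LabelStar,
        Set ((logShellsDH (pilotDataOfK T.D T.K) (analyticLogv T.K)).GlobalPacket j.1))
      (region : ℤ → ∀ j : (thetaIndex (pilotDataOfK T.D T.K)).LabelStar, FinDivisor M →
        ∀ vQ : (thetaIndex (pilotDataOfK T.D T.K)).VQ, Set ((logShellsDH (pilotDataOfK T.D T.K) (analyticLogv T.K)).Packet j.1 vQ))
      (frobAdm : ℤ → ℤ → ∀ (j : (thetaIndex (pilotDataOfK T.D T.K)).Label) (vQ : (thetaIndex (pilotDataOfK T.D T.K)).VQ),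
        Set ((logShellsDH (pilotDataOfK T.D T.K) (analyticLogv T.K)).Packet j vQ) → Prop)
      (frobLogvol : ℤ → ℤ → ∀ (j : (thetaIndex (pilotDataOfK T.D T.K)).Label) (vQ : (thetaIndex (pilotDataOfK T.D T.K)).VQ),
        Set ((logShellsDH (pilotDataOfK T.D T.K) (analyticLogv T.K)).Packet j vQ) → ℝ)
      (frobΨ : ℤ → ℤ → ∀ v : (thetaIndex (pilotDataOfK T.D T.K)).V, v ∈ (thetaIndex (pilotDataOfK T.D T.K)).Vbad →
        Set ((logShellsDH (pilotDataOfK T.D T.K) (analyticLogv T.K)).StarPacket v))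
      (frobMmod : ℤ → ℤ → ∀ j : (thetaIndex (pilotDataOfK T.D T.K)).LabelStar,
        Set ((logShellsDH (pilotDataOfK T.D T.K) (analyticLogv T.K)).GlobalPacket j.1))
      (unitImage : ℤ → ℤ → ℕ → ∀ (j : (thetaIndex (pilotDataOfK T.D T.K)).Label) (vQ : (thetaIndex (pilotDataOfK T.D T.K)).VQ),
        Set ((logShellsDH (pilotDataOfK T.D T.K) (analyticLogv T.K)).Packet j vQ))
      (ballImage : ℤ → ℤ → ∀ (j : (thetaIndex (pilotDataOfK T.D T.K)).Label) (vQ : (thetaIndex (pilotDataOfK T.D T.K)).VQ),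
        Set ((logShellsDH (pilotDataOfK T.D T.K) (analyticLogv T.K)).Packet j vQ))
      (thetaDiv : ℤ → ℤ → LgpDivisor M (thetaIndex (pilotDataOfK T.D T.K)).lstar)
      (n : ℤ) {HT : Type} {LogLink : HT → HT → Type} {IsFull : ∀ {s t : HT}, LogLink s t → Prop}
      (lat : LGPGaussianLogThetaLattice LogLink IsFull)
      {Frd : Type} {IsoF : Frd → Frd → Type} {Ob : Frd → Type} {realify : Frd → Frd} {Strip : Type}
      {IsoS : Strip → Strip → Type} {Mv : ∀ v : (thetaIndex (pilotDataOfK T.D T.K)).V, v ∈ (thetaIndex (pilotDataOfK T.D T.K)).Vbad → Type}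
      [∀ v h, Monoid (Mv v h)]
      (sig : GlobalLGPFrobenioidSignature (thetaIndex (pilotDataOfK T.D T.K)).lstar (thetaIndex (pilotDataOfK T.D T.K)).V
        (· ∈ (thetaIndex (pilotDataOfK T.D T.K)).Vbad) Frd IsoF Ob realify Strip IsoS Mv)
      (split : SplittingMonoids Mv) {ObΔ : Type}
      {N : ∀ v : (thetaIndex (pilotDataOfK T.D T.K)).V, v ∈ (thetaIndex (pilotDataOfK T.D T.K)).Vbad → Type}
      [∀ v h, Monoid (N v h)] (qData : QPilotData ObΔ N)
      (qK : ∀ v : (thetaIndex (pilotDataOfK T.D T.K)).V, v ∈ (thetaIndex (pilotDataOfK T.D T.K)).Vbad →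
        Set ((logShellsDH (pilotDataOfK T.D T.K) (analyticLogv T.K)).StarPacket v)),
    ¬ Cor312Vol.PilotKummerCompatHull
        (LatticeSituation.ofShells (logShellsDH (pilotDataOfK T.D T.K) (analyticLogv T.K)) M archPk archSub
          (summandPiecesPr (pilotDataOfK T.D T.K) (logvAnalytic_analyticLogv (F := T.K))).Adm
          (summandPiecesPr (pilotDataOfK T.D T.K) (logvAnalytic_analyticLogv (F := T.K))).logvol Ψ act Mmod region frobAdm
          frobLogvol frobΨ frobMmod unitImage ballImage thetaDiv)
        (settingPrVolSharp (pilotDataOfK T.D T.K) (logvAnalytic_analyticLogv (F := T.K)) M archPk archSub Ψ act Mmod region n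
          lat sig split qData (exists_realising_qIdeles_pilotDataOfK T.D).choose (exists_realising_thetaIdeles_pilotDataOfK T.D).choose
          (exists_realising_qIdeles_pilotDataOfK T.D).choose_spec.1 (exists_realising_qIdeles_pilotDataOfK T.D).choose_spec.2.1)
        (fun _ => Cor312.Setting.qRegion
          (settingPrVolSharp (pilotDataOfK T.D T.K) (logvAnalytic_analyticLogv (F := T.K)) M archPk archSub Ψ act Mmod region n
            lat sig split qData (exists_realising_qIdeles_pilotDataOfK T.D).choose (exists_realising_thetaIdeles_pilotDataOfK T.D).choose
            (exists_realising_qIdeles_pilotDataOfK T.D).choose_spec.1 (exists_realising_qIdeles_pilotDataOfK T.D).choose_spec.2.1))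
        qK := by
  have hp : (pp : ℕ).Prime := pp.2
  have hp2 : (pp : ℕ) ≠ 2 := by rcases hpq with ⟨h, -⟩ | ⟨h, -⟩ <;> omega
  have habc0 : a * b * c ≠ 0 := by
    obtain ⟨ha, hb, hsum, -⟩ := habc
    exact Nat.mul_ne_zero (Nat.mul_ne_zero ha.ne' hb.ne') (by omega)
  have htv : (a * b * c).factorization pp = t := by
    have h1 : t ≤ (a * b * c).factorization pp := (hp.pow_dvd_iff_le_factorization habc0).1 hdvd
    have h2 : ¬ t + 1 ≤ (a * b * c).factorization pp := fun h => hndvd ((hp.pow_dvd_iff_le_factorization habc0).2 h)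
    omega
  have hdvd1 : (pp : ℕ) ∣ a * b * c := (dvd_pow_self _ ht.ne').trans hdvd
  have hpole : ∀ v : HeightOneSpectrum (𝓞 ℚ), Rat.HeightOneSpectrum.natGenerator v = pp →
      Literature.IUT.LogVolume.ord ℚ v (Cor22.jInv ((a : ℚ) / c)) = -(2 * (t : ℤ)) := by
    intro v hv
    rw [Cor22.ord_jInv_ratPoint_triple_eq habc v (by rw [hv]; exact hp2) (by rw [hv]; exact hdvd1), hv, htv]
  exact GenuineK.not_pilotKummerCompatHull_chosen_ratPoint_of_wildUnitCell T pp hpq hpl ht hpole hpt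
    (RadTriple.unit_test_of_dvd_of_not_sq_dvd habc pp.2 hp2 ht hdvd hD1 hD2) hi hcell

end Engine

end Summit.ABC.IUTFork.Conditional

end
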